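import Literature.Computation.Certificates.SumOfSquares

/-!
# The monomial order `blt` of the SOS certificate format is the lexicographic order

Review evidence for the lane-sdp2lean REVIEW-RUNBOOK (ops-runbook sanity registry
`registry/lane-sdp2lean.json`; definition card `SOS.Monomial.blt`); no new definitions.
`Monomial = List ℕ` (exponent vectors `(α₁, …, αₙ)`) and `blt α β` compares them entry by entry, the
first differing exponent deciding — the **lexicographic order** of Cox–Little–O'Shea, *Ideals,
Varieties, and Algorithms*, Ch. 2 §2 Def. 3 («α >_lex β if the leftmost nonzero entry of α − β is
positive»; here `blt α β = true` reads `α <_lex β`), which on `List ℕ` is core Lean's `<`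
(`List.Lex (· < ·)`).  On vectors of unequal length a proper prefix counts as smaller (the format does
not fix the number of variables; `Monomial.trim` removes trailing zeros) — outside the book's setting of
a fixed `n`, recorded here as the one deviation.  [cite: CoxLittleOShea2007, Ch. 2 §2 Def. 3]

* (a) agreement: `blt α β = true ↔ α < β` (`blt_eq_true_iff_lt`), so `blt` decides the lex order;
* computed values: the book's own examples after Def. 3 — `(0,3,4) <_lex (1,2,0)`, `(3,2,1) <_lex (3,2,4)`,
  and the variable order `x >_lex y >_lex z` (`(0,1,0) <_lex (1,0,0)`, `(0,0,1) <_lex (0,1,0)`);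
* (b) irreflexive, as a (strict) monomial ordering must be (Ch. 2 §2 Prop. 4: lex is a monomial order).
-/

namespace Literature.Computation.Certificates.SOS.Monomial

/-- **Lexicographic order** (Cox–Little–O'Shea, Ch. 2 §2 Def. 3: `α >_lex β` iff the leftmost nonzero
entry of `α − β` is positive): the checker's Boolean comparison `blt α β = true` holds exactly when
`α < β` in the lexicographic order core Lean puts on exponent vectors `List ℕ` (`List.Lex (· < ·)` — the
first differing entry decides; a proper prefix is smaller, the one deviation for vectors of unequal
length, which the book's fixed-`n` setting does not have). [cite: CoxLittleOShea2007, Ch. 2 §2 Def. 3] -/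
theorem blt_eq_true_iff_lt : ∀ α β : Monomial, blt α β = true ↔ α < β
  | [], [] => by simp [blt]
  | [], _ :: _ => by simp [blt]
  | _ :: _, [] => by simp [blt]
  | e :: es, e' :: es' => by
      rw [blt, Bool.or_eq_true, Bool.and_eq_true, Nat.blt_eq, Nat.beq_eq, blt_eq_true_iff_lt es es',
        List.cons_lt_cons_iff]

/-- `blt` DECIDES the lexicographic order of Ch. 2 §2 Def. 3: `blt α β = decide (α < β)`.
[cite: CoxLittleOShea2007, Ch. 2 §2 Def. 3] -/
theorem blt_eq_decide (α β : Monomial) : blt α β = decide (α < β) := by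
  rw [← Bool.coe_iff_coe, decide_eq_true_iff, blt_eq_true_iff_lt]

/-- The book's first example after Def. 3: `(1,2,0) >_lex (0,3,4)` since `α − β = (1,−1,−4)` — here
`blt [0,3,4] [1,2,0] = true`. [cite: CoxLittleOShea2007, Ch. 2 §2 Def. 3] -/
theorem blt_example_a : blt [0, 3, 4] [1, 2, 0] = true := by decide

/-- The book's second example after Def. 3: `(3,2,4) >_lex (3,2,1)` since `α − β = (0,0,3)` — the first
two entries agree, the third decides: `blt [3,2,1] [3,2,4] = true`. [cite: CoxLittleOShea2007, Ch. 2 §2 Def. 3] -/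
theorem blt_example_b : blt [3, 2, 1] [3, 2, 4] = true := by decide

/-- The variables themselves are ordered `x₁ >_lex x₂ >_lex x₃` (the remark after Def. 3): as exponent
vectors `(0,1,0) <_lex (1,0,0)` and `(0,0,1) <_lex (0,1,0)`, and not conversely.
[cite: CoxLittleOShea2007, Ch. 2 §2 Def. 3] -/
theorem blt_variables :
    blt [0, 1, 0] [1, 0, 0] = true ∧ blt [0, 0, 1] [0, 1, 0] = true ∧ blt [1, 0, 0] [0, 1, 0] = false := by
  decide

/-- Lex is a monomial ORDERING (Ch. 2 §2 Prop. 4) — in particular strict: no exponent vector precedes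
itself, `blt α α = false`. [cite: CoxLittleOShea2007, Ch. 2 §2 Prop. 4] -/
theorem blt_irrefl (α : Monomial) : blt α α = false := by
  rw [blt_eq_decide, decide_eq_false_iff_not]
  exact lt_irrefl α

end Literature.Computation.Certificates.SOS.Monomial
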